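/-
Copyright: the b2b-balaban T⁴-continuum CRUX team, row NE7b owner lineage `t4-ne7b-p1` (gen 115). Project licence.
-/
import Summits.QuantumFields.BalabanUV.T4Continuum.Spine.NE7b.SupBackgroundPeriodic

/-!
# GLOBAL UNIQUENESS OF THE BACKGROUND FROM THE A-PRIORI LETTER: two `ℓ^∞` solutions of (60)'s sitewise background equation
# `A φ(p) + u(φ(p)) = ` its block mean, with the same block means `Q′φ = Q′ψ`, COINCIDE whenever `u` is `λ`-Lipschitz and
# `2λC_Γ(0) < 1` — their difference solves the LINEARISED system with the diagonal difference-quotient multiplier (`|·| ≤ λ`) and zero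
# data, which (63)'s `weighted_apriori` bounds by `0`; no radius, no chart; hence the background `σ` of (63) §4 (exported WITHOUT a
# uniqueness letter) is unique among all `ℓ^∞` solutions, and PERIODIC for periodic coarse fields by (73)'s competitor argument
# (row NE7b, node U5c; (63) + (73) BY NAME; [folklore])

Cell `pub-balaban`, sub-cell `t4`, spine estimate NE7b (`T4WeightBudget.RelWeightBound`; the cell's OWN estimate — NOT PRINTED in
[Bałaban 1983–89], NOT PROVED).  Crux-route work under `Spine/NE7b/` by the row OWNER (`t4-ne7b-p1` gen 115) under FREEZE (0)'s
crux-prover clause (FILING-CLAIM C-ne7bp1-g115-13); NOTHING of Bałaban's is named, valued or asserted; no `def`, no notation; zero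
`sorry`.  Imports (BY NAME): the owner's (73) `…SupBackgroundPeriodic` (`exists_clm_translate`, `translate_norm_le`,
`sum_AX_translate_apply`, `blockAvg_translate_apply`; through it (63) `weighted_apriori`, (58) `exists_clm_mul`, `abs_apply_le_norm`,
(55) `blk_translate`, `sum_B_translate`), Mathlib `Convex.norm_image_sub_le_of_norm_hasDerivWithin_le`.

WHY (located).  (73) §3 derives periodicity of the background from (60) `exists_background`'s uniqueness letter; (63) §4 — the theorem
that carries the weighted letters — re-exports (60) v1.1, whose conclusion list has NO uniqueness clause, so a consumer could not have
BOTH the localisation letters and periodicity for the same `σ`.  The gap closes without another re-export: uniqueness is a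
CONSEQUENCE of the displayed sitewise letter plus (63)'s a-priori letter at the zero weight (the linearised system with any diagonal
multiplier of size `≤ λ` has only the zero solution for zero data), and `λ`-Lipschitz `u` turns the difference of two nonlinear
solutions into such a system.

WHAT IS PROVED ([folklore]; `ℓ^∞ := lp (fun _ : X d => ℝ) ∞`):
* `abs_sub_le_of_deriv` (`|u′| ≤ λ` ⟹ `|u a − u b| ≤ λ|a − b|`).
* **`eq_of_sitewise`** (`d ≥ 3`, `2λC_Γ(0) < 1`, `u` `λ`-Lipschitz): `Q′φ = Q′ψ` and the sitewise equation for `φ` and `ψ` ⟹ `φ = ψ`.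
* **`background_periodic`** (`d ≥ 3`, same smallness): for ANY `σ` with (63) §4's closed-ball sitewise letter on a set `S` of coarse
  fields (`Q′(σw) = w`, the sitewise equation), `w ∈ S` `s`-periodic ⟹ `σ w` is `side·s`-periodic — (73) §3 with its uniqueness
  hypothesis DISCHARGED by `eq_of_sitewise` (the translate has the same block means and solves the same equation).

HONEST (what this is NOT).  Letters-level; smallness `2λC_Γ(0) < 1` is (60)'s `2λ ≤ c < N⁻¹ ≤ N_∞⁻¹` read at `C_Γ ≤ N_∞`, taken as a
hypothesis; nothing of Bałaban's.  BY-NAME EFFECT ON THE WALL: NONE.  NE7b NOT PRINTED ∕ NOT PROVED; spine PROVED 0∕9; rung (B)+1 on a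
FINITE torus — NOT infinite volume, NOT the mass gap, NOT Clay.  HONEST DEPENDENCY: continuum YM on T⁴ ⇐ BetaPertH ∧ nine spine
estimates (0∕9 proved); BetaPertH ⇐ (D1) ∧ (D4) ∧ CAP+tail; G-an2-4 gates asym, D1 and NE2∕3∕4.
-/

set_option autoImplicit false

noncomputable section

namespace Summit.QuantumFields.BalabanUV.T4Continuum.NE7b.SupBackgroundUniqueness

open Set Metric
open scoped ENNReal
open Literature.MathematicalPhysics.QuantumFieldTheory.Balaban1983to89
open B4Sect5Proof (latticeConst latticeConst_nonneg)
open B6QGQLower276 (X blk B side AX)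
open B6QGQDecay237 (deltaU deltaU_pos)
open B5Hk103ScalarZd (nbhd deltaH deltaH_pos)
open Summit.QuantumFields.BalabanUV.Beta.D1BFx.BlockColumnSupNorm (cHs cHs_nonneg)
open Summit.QuantumFields.BalabanUV.Beta.D1BFx.PointColumnSplit (cKL cG0 cSplit)
open Summit.QuantumFields.BalabanUV.Beta.D1BFx.PointColumnDecay (cFar)
open LocalNemytskiiSup (exists_clm_mul abs_apply_le_norm)
open OneShotChartTorusRowsZd (blk_translate sum_B_translate)
open SupBackgroundLocalisation (weighted_apriori)
open SupBackgroundPeriodic (exists_clm_translate translate_norm_le sum_AX_translate_apply blockAvg_translate_apply)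

variable {d : ℕ}

/-- `|u′| ≤ λ` everywhere ⟹ `u` is `λ`-Lipschitz (the one-dimensional mean-value inequality). [folklore] -/
theorem abs_sub_le_of_deriv {u u' : ℝ → ℝ} (hu : ∀ t, HasDerivAt u (u' t) t) {lam : ℝ} (hlam : ∀ t, |u' t| ≤ lam) (a b : ℝ) :
    |u a - u b| ≤ lam * |a - b| := by
  have h := Convex.norm_image_sub_le_of_norm_hasDerivWithin_le (f := u) (f' := u') (s := Set.univ)
    (fun t _ => (hu t).hasDerivWithinAt) (fun t _ => by rw [Real.norm_eq_abs]; exact hlam t) convex_univ (Set.mem_univ b)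
    (Set.mem_univ a)
  rwa [Real.norm_eq_abs, Real.norm_eq_abs] at h

/-- **TWO `ℓ^∞` SOLUTIONS OF THE SITEWISE BACKGROUND EQUATION WITH THE SAME BLOCK MEANS COINCIDE** (`d ≥ 3`, `2λC_Γ(0) < 1`, `u`
`λ`-Lipschitz): the difference solves the linearised system with the difference-quotient multiplier and zero data; (63)
`weighted_apriori` at the zero weight bounds it by `0`.  No radius, no chart. [folklore] -/
theorem eq_of_sitewise (hd : 3 ≤ d) (n : ℕ) {a : ℝ} (ha : 0 < a)
    (Dop Aop Pop : lp (fun _ : X d => ℝ) ∞ →L[ℝ] lp (fun _ : X d => ℝ) ∞)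
    (hD : ∀ (f : lp (fun _ : X d => ℝ) ∞) (y : X d), Dop f y = (((n : ℝ) + 1) ^ d)⁻¹ * ∑ p ∈ B n y, f p)
    (hA : ∀ (f : lp (fun _ : X d => ℝ) ∞) (p : X d), Aop f p = ∑ r ∈ nbhd n p, AX n a p r * f r)
    (hP : ∀ (f : lp (fun _ : X d => ℝ) ∞) (p : X d), Pop f p = f p - (((n : ℝ) + 1) ^ d)⁻¹ * ∑ p' ∈ B n (blk n p), f p')
    {u : ℝ → ℝ} {lam : ℝ} (hlam : 0 ≤ lam) (hul : ∀ s t : ℝ, |u s - u t| ≤ lam * |s - t|)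
    (hsmall : 2 * lam * (((cG0 d * cKL d (d - 2) + cSplit d a) * Real.exp (2 * deltaU d a)
        + cFar d a * Real.exp (4 * deltaU d a) / deltaU d a ^ 2) * latticeConst d (deltaU d a / 4)
          * (1 + cHs d a * latticeConst d (deltaH d a))) < 1)
    (φ ψ : lp (fun _ : X d => ℝ) ∞) (hDeq : Dop φ = Dop ψ)
    (hφ : ∀ p : X d, Aop φ p + u (φ p) = (((n : ℝ) + 1) ^ d)⁻¹ * ∑ p' ∈ B n (blk n p), (Aop φ p' + u (φ p')))
    (hψ : ∀ p : X d, Aop ψ p + u (ψ p) = (((n : ℝ) + 1) ^ d)⁻¹ * ∑ p' ∈ B n (blk n p), (Aop ψ p' + u (ψ p'))) :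
    φ = ψ := by
  classical
  -- the difference-quotient multiplier
  obtain ⟨g, hg, hgk⟩ : ∃ g : X d → ℝ, (∀ p, |g p| ≤ lam) ∧ ∀ p, g p * (φ p - ψ p) = u (φ p) - u (ψ p) := by
    refine ⟨fun p => if φ p = ψ p then 0 else (u (φ p) - u (ψ p)) / (φ p - ψ p), fun p => ?_, fun p => ?_⟩
    · by_cases h : φ p = ψ p
      · simp only [h, if_true, abs_zero]; exact hlam
      · simp only [h, if_false]
        rw [abs_div, div_le_iff₀ (abs_pos.2 (sub_ne_zero.2 h))]
        exact hul _ _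
    · by_cases h : φ p = ψ p
      · simp only [h, if_true, zero_mul, sub_self]
      · simp only [h, if_false]; rw [div_mul_cancel₀ _ (sub_ne_zero.2 h)]
  obtain ⟨Nop, hN, -⟩ := exists_clm_mul (ι := X d) g hlam hg
  -- the difference solves the linearised system with zero data
  have hk1 : Dop (φ - ψ) = 0 := by rw [map_sub, hDeq, sub_self]
  have hk2 : Pop (Aop (φ - ψ) + Nop (φ - ψ)) = 0 := by
    refine lp.ext (funext fun p => ?_)
    have e : ∀ q : X d, (Aop (φ - ψ) + Nop (φ - ψ)) q = (Aop φ q + u (φ q)) - (Aop ψ q + u (ψ q)) := fun q => by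
      rw [lp.coeFn_add, Pi.add_apply, hN, lp.coeFn_sub, Pi.sub_apply, hgk, map_sub, lp.coeFn_sub, Pi.sub_apply]; ring
    rw [hP, e, Finset.sum_congr rfl fun p' _ => e p', Finset.sum_sub_distrib, mul_sub, hφ p, hψ p, lp.coeFn_zero,
      Pi.zero_apply]
    ring
  -- (63)'s a-priori letter at the zero weight
  have hz : ∀ y : X d, Real.exp (0 * (0 : ℝ)) * |(0 : lp (fun _ : X d => ℝ) ∞) y| ≤ 0 := fun y => by
    rw [lp.coeFn_zero, Pi.zero_apply, abs_zero, mul_zero]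
  have hsmall' : 2 * lam * (((cG0 d * cKL d (d - 2) + cSplit d a) * Real.exp (2 * deltaU d a)
      + cFar d a * Real.exp (4 * deltaU d a) / deltaU d a ^ 2) * latticeConst d (deltaU d a / 4 - 0)
        * (1 + cHs d a * latticeConst d (deltaH d a - 0))) < 1 := by rwa [sub_zero, sub_zero]
  refine lp.ext (funext fun q => ?_)
  have hb := weighted_apriori hd n ha Dop Aop Pop Nop hD hA hP hN hg (μ := 0) le_rfl (deltaH_pos d ha)
    (by have := deltaU_pos d ha; positivity) hsmall' (ρ := fun _ => (0 : ℝ)) (fun _ _ => by rw [sub_self]; exact dist_nonneg)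
    (Mρ := 0) (fun _ => by rw [abs_zero]) (φ - ψ) 0 0 (map_zero Dop) hk1 hk2 hz hz q
  have hb' : |(φ - ψ) q| ≤ 0 := by
    simpa only [mul_zero, zero_mul, add_zero, zero_add, Real.exp_zero, one_mul] using hb
  have e3 := abs_nonpos_iff.1 hb'
  rwa [lp.coeFn_sub, Pi.sub_apply, sub_eq_zero] at e3

/-- **THE BACKGROUND OF (63) §4 IS PERIODIC FOR PERIODIC COARSE FIELDS** (`d ≥ 3`, `2λC_Γ(0) < 1`, `|u′| ≤ λ`): for `Q′, A, P` with
the displayed actions and ANY `σ` with the closed-ball sitewise letter on a set `S` (`Q′(σw) = w` and the sitewise equation — the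
shape (63) `exists_background_covariance_localised` exports, no uniqueness clause needed), `w ∈ S` `s`-periodic ⟹ `σ w` is
`side·s`-periodic: the translate `τ(σw)` has block means `w` and solves the same equation, so `eq_of_sitewise` identifies it with
`σ w`. [folklore] -/
theorem background_periodic (hd : 3 ≤ d) (n : ℕ) {a : ℝ} (ha : 0 < a)
    (Dop Aop Pop : lp (fun _ : X d => ℝ) ∞ →L[ℝ] lp (fun _ : X d => ℝ) ∞)
    (hD : ∀ (f : lp (fun _ : X d => ℝ) ∞) (y : X d), Dop f y = (((n : ℝ) + 1) ^ d)⁻¹ * ∑ p ∈ B n y, f p)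
    (hA : ∀ (f : lp (fun _ : X d => ℝ) ∞) (p : X d), Aop f p = ∑ r ∈ nbhd n p, AX n a p r * f r)
    (hP : ∀ (f : lp (fun _ : X d => ℝ) ∞) (p : X d), Pop f p = f p - (((n : ℝ) + 1) ^ d)⁻¹ * ∑ p' ∈ B n (blk n p), f p')
    {u u' : ℝ → ℝ} (hu : ∀ t, HasDerivAt u (u' t) t) {lam : ℝ} (hlam : ∀ t, |u' t| ≤ lam)
    (hsmall : 2 * lam * (((cG0 d * cKL d (d - 2) + cSplit d a) * Real.exp (2 * deltaU d a)
        + cFar d a * Real.exp (4 * deltaU d a) / deltaU d a ^ 2) * latticeConst d (deltaU d a / 4)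
          * (1 + cHs d a * latticeConst d (deltaH d a))) < 1)
    {σ : lp (fun _ : X d => ℝ) ∞ → lp (fun _ : X d => ℝ) ∞} {S : Set (lp (fun _ : X d => ℝ) ∞)}
    (hσ : ∀ w ∈ S, Dop (σ w) = w ∧
      ∀ p : X d, Aop (σ w) p + u (σ w p) = (((n : ℝ) + 1) ^ d)⁻¹ * ∑ p' ∈ B n (blk n p), (Aop (σ w) p' + u (σ w p')))
    (s : ℕ) {w : lp (fun _ : X d => ℝ) ∞} (hw : w ∈ S) (hper : ∀ y t : X d, w (y + (s : ℤ) • t) = w y) (q t : X d) :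
    σ w (q + side n • ((s : ℤ) • t)) = σ w q := by
  obtain ⟨hDw, heq⟩ := hσ w hw
  obtain ⟨τ, hτ, -⟩ := exists_clm_translate (side n • ((s : ℤ) • t))
  have hlam0 : 0 ≤ lam := (abs_nonneg _).trans (hlam 0)
  have hAτ : ∀ p : X d, Aop (τ (σ w)) p = Aop (σ w) (p + side n • ((s : ℤ) • t)) := fun p => by
    rw [hA, hA]; exact sum_AX_translate_apply n a ((s : ℤ) • t) (fun q' => hτ (σ w) q') p
  have hφeq : ∀ p : X d, Aop (τ (σ w)) p + u (τ (σ w) p)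
      = (((n : ℝ) + 1) ^ d)⁻¹ * ∑ p' ∈ B n (blk n p), (Aop (τ (σ w)) p' + u (τ (σ w) p')) := by
    intro p
    rw [hAτ, hτ, heq (p + side n • ((s : ℤ) • t)), blk_translate, sum_B_translate]
    exact congrArg _ (Finset.sum_congr rfl fun p' _ => by rw [hAτ, hτ])
  have hDφ : Dop (τ (σ w)) = Dop (σ w) := by
    rw [hDw]
    refine lp.ext (funext fun y => ?_)
    rw [hD, blockAvg_translate_apply n ((s : ℤ) • t) (fun q' => hτ (σ w) q') y, ← hD, hDw, hper]
  have h := eq_of_sitewise hd n ha Dop Aop Pop hD hA hP hlam0 (abs_sub_le_of_deriv hu hlam) hsmall _ _ hDφ hφeq heq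
  have h' := congrArg (fun f : lp (fun _ : X d => ℝ) ∞ => f q) h
  simp only [hτ] at h'
  exact h'

end Summit.QuantumFields.BalabanUV.T4Continuum.NE7b.SupBackgroundUniqueness

end
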